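import Summits.SmoothPoincare4.SmoothPoincare4.Theorems.CongruenceShadowsAgkCor6SufficiencySpineDefs
import Summits.SmoothPoincare4.SmoothPoincare4.Theorems.CongruenceShadowsAgkCor6SufficiencyStubUnitSectorProfile
import Literature.Topology.FourManifolds.TrisectionsTriNormalForm
import Literature.Topology.FourManifolds.TrisectionsAmbientMorse
import Literature.Topology.FourManifolds.TrisectionsSectorMorse
import Literature.Topology.FourManifolds.CollarUniquenessBall

/-!
# Stub `stub_unitSector` of line `lp-by-sphere-system-surgery` for crux `AgkCor6Sufficiency`
(item stmt-SmoothPoincare4-10894, routes CongruenceShadows / GroupTrisection; lead reshape r5, A1)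

**Unit normalisation of a sector normal form.**  The tree's ambient Morse presentation of a
sector in normal form (`SectorNormalForm.morse`) has corner form `G = 1 - 2uv·κ` on an open
`Oκ ⊇ F`, with `κ > 0` smooth and `ρ`-invariant.  We produce another presentation `G̃` of the same
sector (all Morse clauses, same counts) which is the **unit** corner form `1 - 2uv` on an open
`T ⊇ F` (`UnitSectorForm`, `…SpineDefs.lean`).

Proof.  Put `V = Oκ ∩ ⋃ (corner-chart sources)` and let `V₁` (`F ⊆ V₁`, `closure V₁ ⊆ V`) and
`η₀ > 0` be given by the tree's `exists_localised_cutoff'` (`u² + v² > η₀` on `closure V₁ ∖ V₁`).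
On the compact `closure V₁` one has `0 < m₁ ≤ min(κ, 1)` and `κ ≤ M₁`; with
`ε = m₁ / (8(M₁ + 1))` take the log-slow step `ℓ` of `exists_logSlow_profile` (`ℓ = 1` on
`(-∞, a]`, `= 0` on `[1, ∞)`, `|sℓ'(s)| ≤ ε`) and set `χ = ℓ((u² + v²)/η₀)` on `V₁`, `0` outside —
smooth, since it vanishes near the frontier of `V₁` — and
`G̃ = G - 2uv·χ·(1 - κ) = 1 - 2uv·k`, `k = κ + χ(1 - κ) > 0` on `V₁`, `G̃ = 1 - 2uv` on
`T = V₁ ∩ {u² + v² < η₀ a}`.  Off `V₁`, `G̃ = G` locally.  On `V₁ ∩ S ∖ F` the function `G̃` has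
no critical points: in a corner-slice chart `Θ` it reads
`1 - 2 w₀ w₁ [K(w') + ℓ((w₀² + w₁²)/η₀)(1 - K(w'))]` (`κ` is constant along the normal
directions, being `ρ`-invariant), whose derivative along the normal line through a point with
`w₁ > 0` is `-2w₁(A + B)`, `A ≥ m₁`, `|B| ≤ 2ε|1 - K| ≤ m₁/4` (`fderiv_ne_zero_of_unitBlend`,
`…StubUnitSectorProfile.lean`).  Since `G` has no critical points on `S ∩ Oκ ∖ F` either, the
interior critical sets, Hessians and counts of `G̃` and `G` agree.  This is the computation of
Abrams–Gay–Kirby, proof of Thm. 5 (normal forms near the central surface), written for the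
tree's ambient presentations as in `SectorNormalForm.exists_morse_const`
(`TrisectionsKappaConst.lean`), from which the bookkeeping is adapted.

References: Abrams–Gay–Kirby, Geom. Topol. 22 (2018), proof of Thm. 5 [AbramsGayKirby2018];
Gay–Kirby, Geom. Topol. 20 (2016), Def. 1 [GayKirby2016]; Milnor, *Morse theory* (1963), §2
[Milnor1963].
-/

noncomputable section

-- the prescribed namespace `Summit.<P>.<Sub>.…` duplicates `SmoothPoincare4` (P = Sub)
set_option linter.dupNamespace false

open Set Function Filter
open scoped Manifold ContDiff Topology

namespace Summit.SmoothPoincare4.SmoothPoincare4.Cruxes.AgkCor6Sufficiency.LpBySphereSystemSurgery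

open Literature.Topology.FourManifolds

/-! ## The statement (verbatim from the skeleton) -/

/-- **A1 — unit normalisation of a sector normal form**: the ambient Morse presentation of a
sector in normal form can be chosen of unit corner form `1 - 2uv` near the central surface
(blend `κ → 1` with a logarithmic cutoff in `u² + v²`; no new critical points: in a corner-slice
chart an interior critical point of `1 - 2 y₀ y₁ k(y₀² + y₁², y')` forces `y₀ = y₁` and
`d(t k)/dt = 0`, excluded by `|t ℓ'(t)| ≤ C₀ / L`). -/
def UnitSectorStmt : Prop :=
  ∀ (X : Type) [TopologicalSpace X] [T2Space X] [SecondCountableTopology X]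
    [ChartedSpace (EuclideanSpace ℝ (Fin 4)) X] [IsManifold (𝓡 4) ∞ X] [CompactSpace X]
    (S F : Set X) (u v : X → ℝ) (ρ : X → X) (U O : Set X) (c : ℕ → ℕ),
    NormalFrame F u v ρ U O → SectorNormalForm S F u v ρ U O c →
    ∃ (T : Set X) (G : X → ℝ), UnitSectorForm S F u v ρ U O T G c

/-! ## The proof -/

/-- **Registered stub `stub_unitSector`** (A1 of line `lp-by-sphere-system-surgery`): every sector
normal form admits an ambient Morse presentation of unit corner form `1 - 2uv` near the central
surface. [cite: AbramsGayKirby2018, proof of Thm. 5] -/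
theorem stub_unitSector : UnitSectorStmt := by
  intro X _ _ _ _ _ _ S F u v ρ U O c hfr hS
  obtain ⟨G, κ, Oκ, hGs, hκs, hOκo, hFOκ, hOκO, hκpos, hκρ, hGform, hb1, hi1, hb2, hi2, hnocrit, hc⟩ :=
    hS.morse
  -- ### the zone `V = Oκ ∩ ⋃ sources`, `V₁ ⋐ V` and the frontier bound
  set V : Set X := Oκ ∩ ⋃ C : CornerSliceChart S F u v ρ, C.Θ.source with hV
  have hVo : IsOpen V := hOκo.inter (isOpen_iUnion fun C => C.Θ.open_source)
  have hFV : F ⊆ V := fun x hx => ⟨hFOκ hx, by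
    obtain ⟨C, hxC, -⟩ := hS.corner x hx
    exact mem_iUnion.2 ⟨C, hxC⟩⟩
  have hVOκ : V ⊆ Oκ := inter_subset_left
  have hVU : V ⊆ U := fun y hy => hfr.O_subset_U (hOκO hy.1)
  have hVzero : ∀ y ∈ V, u y = 0 → v y = 0 → y ∈ F := fun y hy hu hv =>
    (hfr.memF_iff y (hVU hy)).2 ⟨hu, hv⟩
  obtain ⟨V₁, η₀, hV₁o, hFV₁, hclV₁, hη₀, hfront, -⟩ :=
    exists_localised_cutoff' hfr.isClosed_F hVo hFV hfr.contMDiff_u hfr.contMDiff_v hVzero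
  have hV₁V : V₁ ⊆ V := subset_closure.trans hclV₁
  have hV₁Oκ : V₁ ⊆ Oκ := hV₁V.trans hVOκ
  have hV₁U : V₁ ⊆ U := hV₁V.trans hVU
  -- ### bounds for `κ` on `closure V₁`, the smallness constant `ε`
  have hclc : IsCompact (closure V₁) := isClosed_closure.isCompact
  obtain ⟨M, hM⟩ := hclc.exists_bound_of_continuousOn hκs.continuous.continuousOn
  obtain ⟨m, hm, hmle⟩ : ∃ m : ℝ, 0 < m ∧ ∀ y ∈ closure V₁, m ≤ κ y := by
    rcases (closure V₁).eq_empty_or_nonempty with hK | hK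
    · exact ⟨1, one_pos, fun y hy => by rw [hK] at hy; exact absurd hy (notMem_empty _)⟩
    · obtain ⟨y₀, hy₀, hmin⟩ := hclc.exists_isMinOn hK hκs.continuous.continuousOn
      exact ⟨κ y₀, hκpos y₀ (hVOκ (hclV₁ hy₀)), fun y hy => hmin hy⟩
  set m₁ : ℝ := min m 1 with hm₁
  set M₁ : ℝ := max M 1 with hM₁
  have hm₁pos : 0 < m₁ := lt_min hm one_pos
  have hm₁1 : m₁ ≤ 1 := min_le_right _ _
  have hM₁pos : 0 < M₁ := lt_max_of_lt_right one_pos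
  set ε : ℝ := m₁ / (8 * (M₁ + 1)) with hε
  have hεpos : 0 < ε := by positivity
  have hkey : ∀ y ∈ V₁, m₁ ≤ κ y ∧ 2 * ε * |1 - κ y| ≤ m₁ / 2 := by
    intro y hy
    have hyc := subset_closure hy
    have h1 : m₁ ≤ κ y := (min_le_left _ _).trans (hmle y hyc)
    have h2 : |κ y| ≤ M₁ := by
      have := hM y hyc
      rw [Real.norm_eq_abs] at this
      exact this.trans (le_max_left _ _)
    have h3 : |1 - κ y| ≤ 1 + M₁ := (abs_sub _ _).trans (by rw [abs_one]; linarith)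
    refine ⟨h1, ?_⟩
    calc 2 * ε * |1 - κ y| ≤ 2 * ε * (1 + M₁) := by gcongr
      _ = m₁ / 4 := by rw [hε]; field_simp; ring
      _ ≤ m₁ / 2 := by linarith
  -- ### the log-slow step and the cutoff `χ`
  obtain ⟨ℓ, a, ha, -, hℓs, hℓ01, hℓone, hℓzero, hℓε⟩ := exists_logSlow_profile hεpos
  set r2 : X → ℝ := fun y => u y ^ 2 + v y ^ 2 with hr2
  have hr2s : ContMDiff (𝓡 4) 𝓘(ℝ, ℝ) ∞ r2 := (hfr.contMDiff_u.pow 2).add (hfr.contMDiff_v.pow 2)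
  have hr2c : Continuous r2 := hr2s.continuous
  set P : ℝ → ℝ := fun t => ℓ (t / η₀) with hP
  have hPs : ContDiff ℝ ∞ P := hℓs.comp (contDiff_id.div_const η₀)
  have hPd : Differentiable ℝ P := hPs.differentiable (by simp)
  have hP01 : ∀ t, 0 ≤ P t ∧ P t ≤ 1 := fun t => hℓ01 _
  have hPε : ∀ t, |t * deriv P t| ≤ ε := by
    intro t
    have hd : HasDerivAt P (deriv ℓ (t / η₀) * (1 / η₀)) t :=
      ((hℓs.differentiable (by simp)) _).hasDerivAt.comp t ((hasDerivAt_id' t).div_const η₀)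
    rw [hd.deriv]
    calc |t * (deriv ℓ (t / η₀) * (1 / η₀))| = |t / η₀ * deriv ℓ (t / η₀)| := by
          congr 1; ring
      _ ≤ ε := hℓε _
  set χ : X → ℝ := V₁.indicator fun y => P (r2 y) with hχ
  have hχin : ∀ y ∈ V₁, χ y = P (r2 y) := fun y hy => indicator_of_mem hy _
  have hχout : ∀ y ∉ V₁, χ y = 0 := fun y hy => indicator_of_notMem hy _
  have hχ01 : ∀ y, 0 ≤ χ y ∧ χ y ≤ 1 := by
    intro y
    by_cases hy : y ∈ V₁
    · rw [hχin y hy]; exact hP01 _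
    · rw [hχout y hy]; exact ⟨le_rfl, zero_le_one⟩
  -- `χ` vanishes near every point off `V₁`
  have hχnear : ∀ y ∉ V₁, χ =ᶠ[𝓝 y] fun _ => 0 := by
    intro y hy
    by_cases hyc : y ∈ closure V₁
    · have hr : η₀ < r2 y := hfront y hyc hy
      filter_upwards [(isOpen_lt continuous_const hr2c).mem_nhds hr] with w hw
      by_cases hwV : w ∈ V₁
      · rw [hχin w hwV]
        exact hℓzero _ (by rw [le_div_iff₀ hη₀, one_mul]; exact le_of_lt hw)
      · exact hχout w hwV
    · filter_upwards [isClosed_closure.isOpen_compl.mem_nhds hyc] with w hw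
      exact hχout w (fun h => hw (subset_closure h))
  have hχs : ContMDiff (𝓡 4) 𝓘(ℝ, ℝ) ∞ χ := by
    intro y
    by_cases hyV : y ∈ V₁
    · have heq : χ =ᶠ[𝓝 y] fun w => P (r2 w) := by
        filter_upwards [hV₁o.mem_nhds hyV] with w hw using hχin w hw
      refine ContMDiffAt.congr_of_eventuallyEq ?_ heq
      exact ((contMDiff_iff_contDiff.2 hPs).comp hr2s).contMDiffAt
    · exact contMDiffAt_const.congr_of_eventuallyEq (hχnear y hyV)
  -- ### the new presentation
  set Gt : X → ℝ := fun y => G y - 2 * u y * v y * (χ y * (1 - κ y)) with hGt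
  have hGts : ContMDiff (𝓡 4) 𝓘(ℝ, ℝ) ∞ Gt :=
    hGs.sub (((contMDiff_const.mul hfr.contMDiff_u).mul hfr.contMDiff_v).mul
      (hχs.mul (contMDiff_const.sub hκs)))
  have hGtform : ∀ y ∈ Oκ, Gt y = 1 - 2 * u y * v y * (κ y + χ y * (1 - κ y)) := by
    intro y hy; simp only [hGt]; rw [hGform y hy]; ring
  have hkpos : ∀ y ∈ Oκ, 0 < κ y + χ y * (1 - κ y) := by
    intro y hy
    have h1 := hκpos y hy
    obtain ⟨hb0, hb1'⟩ := hχ01 y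
    have hcc : κ y + χ y * (1 - κ y) = (1 - χ y) * κ y + χ y := by ring
    rw [hcc]
    rcases hb1'.lt_or_eq with hlt | heq
    · nlinarith [mul_pos (sub_pos.2 hlt) h1]
    · rw [heq]; norm_num
  -- `Gt = G` off `V₁`, locally
  have hGteq : ∀ y ∉ V₁, Gt =ᶠ[𝓝 y] fun w => G w + 0 := by
    intro y hy
    filter_upwards [hχnear y hy] with w hw
    simp only [hGt, hw, zero_mul, mul_zero, sub_zero, add_zero]
  -- ### the formula for `Gt` in a corner-slice chart over `V₁`
  have hformula : ∀ (C : CornerSliceChart S F u v ρ), ∀ w ∈ C.Θ.target ∩ C.Θ.symm ⁻¹' V₁,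
      Gt (C.Θ.symm w) = 1 - 2 * w 0 * w 1 * (κ (C.Θ.symm (stratumProj w)) +
        P (w 0 ^ 2 + w 1 ^ 2) * (1 - κ (C.Θ.symm (stratumProj w)))) := by
    rintro C w ⟨hwT, hwV₁⟩
    have hwV₁' : C.Θ.symm w ∈ V₁ := hwV₁
    have hwOκ : C.Θ.symm w ∈ Oκ := hV₁Oκ hwV₁'
    have hwsrc : C.Θ.symm w ∈ C.Θ.source := C.Θ.map_target hwT
    rw [hGtform _ hwOκ]
    have hu' : u (C.Θ.symm w) = w 0 := by rw [← C.apply_zero _ hwsrc, C.Θ.right_inv hwT]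
    have hv' : v (C.Θ.symm w) = w 1 := by rw [← C.apply_one _ hwsrc, C.Θ.right_inv hwT]
    have hκ' : κ (C.Θ.symm w) = κ (C.Θ.symm (stratumProj w)) := by
      rw [← C.π_symm_eq hwT, hκρ _ hwOκ]
    have hχ' : χ (C.Θ.symm w) = P (w 0 ^ 2 + w 1 ^ 2) := by
      rw [hχin _ hwV₁']; simp only [hr2, hu', hv']
    rw [hχ', hu', hv', hκ']
  -- ### `Gt` has no critical points on `S ∩ V₁ ∖ F`
  have hnear : ∀ y ∈ S, y ∈ V₁ → y ∉ F → ¬ IsMCriticalPt (𝓡 4) Gt y := by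
    intro y hyS hyV₁ hyF
    have hyU : y ∈ U := hV₁U hyV₁
    obtain ⟨C, hysrc⟩ : ∃ C : CornerSliceChart S F u v ρ, y ∈ C.Θ.source :=
      mem_iUnion.1 (hV₁V hyV₁).2
    set z : EuclideanSpace ℝ (Fin 4) := C.Θ y with hz
    have hz0 : z 0 = u y := C.apply_zero y hysrc
    have hz1 : z 1 = v y := C.apply_one y hysrc
    have hzT : z ∈ C.Θ.target := C.Θ.map_source hysrc
    obtain ⟨hu0, hv0⟩ := (hS.mem_iff y hyU).1 hyS
    have hne : z 0 ≠ 0 ∨ z 1 ≠ 0 := by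
      rw [hz0, hz1]
      by_contra h
      rw [not_or, not_not, not_not] at h
      exact hyF ((hfr.memF_iff y hyU).2 h)
    -- `Gt` read in the chart
    set Gh : EuclideanSpace ℝ (Fin 4) → ℝ := Gt ∘ C.Θ.symm with hGh
    have hGhd : DifferentiableAt ℝ Gh z := by
      have h1 : ContMDiffOn 𝓘(ℝ, EuclideanSpace ℝ (Fin 4)) 𝓘(ℝ, ℝ) ∞ Gh C.Θ.target :=
        hGts.comp_contMDiffOn C.contMDiffOn_symm
      exact ((contMDiffOn_iff_contDiffOn.mp h1).contDiffAt
        (C.Θ.open_target.mem_nhds hzT)).differentiableAt (by simp)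
    have hmem2 : C.Θ ∈ IsManifold.maximalAtlas (𝓡 4) 2 X :=
      IsManifold.maximalAtlas_subset_of_le (M := X) (I := 𝓡 4) ENat.LEInfty.out C.Θ_mem_maximalAtlas
    have hcrit_iff : IsMCriticalPt (𝓡 4) Gt y ↔ fderiv ℝ Gh z = 0 := by
      rw [isMCriticalPt_iff_fderiv_comp_extend_symm_eq_zero (I := 𝓡 4)
        ((hGts.contMDiffAt (x := y)).of_le ENat.LEInfty.out) hmem2 hysrc]
      have h1 : (Gt ∘ (C.Θ.extend (𝓡 4)).symm) = Gh := by ext w; simp [hGh]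
      have h2 : C.Θ.extend (𝓡 4) y = z := by simp [hz]
      rw [h1, h2]
    rw [hcrit_iff]
    -- the open set over `V₁` and the value of `κ` on the stratum
    have hDo : IsOpen (C.Θ.target ∩ C.Θ.symm ⁻¹' V₁) :=
      C.Θ.continuousOn_symm.isOpen_inter_preimage C.Θ.open_target hV₁o
    have hzD : z ∈ C.Θ.target ∩ C.Θ.symm ⁻¹' V₁ :=
      ⟨hzT, by show C.Θ.symm (C.Θ y) ∈ V₁; rw [C.Θ.left_inv hysrc]; exact hyV₁⟩
    have hk₀ : κ (C.Θ.symm (stratumProj z)) = κ y := by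
      rw [← C.π_symm_eq hzT, hz, C.Θ.left_inv hysrc, hκρ y (hV₁Oκ hyV₁)]
    obtain ⟨hmK, hkB⟩ := hkey y hyV₁
    rw [← hk₀] at hmK hkB
    rw [← hz0] at hu0
    rw [← hz1] at hv0
    exact fderiv_ne_zero_of_unitBlend (K := fun w => κ (C.Θ.symm w)) (P := P) hGhd hDo hzD
      (fun w hw => hformula C w hw) hPd hP01 hPε hm₁pos hm₁1 hmK hkB hu0 hv0 hne
  -- ### the unit region `T`
  set T : Set X := V₁ ∩ r2 ⁻¹' Iio (η₀ * a) with hT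
  have hTo : IsOpen T := hV₁o.inter (isOpen_Iio.preimage hr2c)
  have hFT : F ⊆ T := by
    intro x hx
    obtain ⟨hu, hv⟩ := (hfr.memF_iff x (hfr.F_subset_U hx)).1 hx
    refine ⟨hFV₁ hx, ?_⟩
    show r2 x < η₀ * a
    simp only [hr2, hu, hv]
    norm_num
    positivity
  have hTV₁ : T ⊆ V₁ := inter_subset_left
  have hχT : ∀ y ∈ T, χ y = 1 := by
    rintro y ⟨hyV₁, hyr⟩
    have hyr' : r2 y < η₀ * a := hyr
    rw [hχin y hyV₁]
    exact hℓone _ (by rw [div_le_iff₀ hη₀]; linarith)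
  have hGtT : ∀ y ∈ T, Gt y = 1 - 2 * u y * v y := by
    intro y hy; rw [hGtform y (hV₁Oκ (hTV₁ hy)), hχT y hy]; ring
  -- ### the clauses of the presentation
  have hb1' : ∀ p ∈ S, p ∉ interior S → Gt p = 1 := by
    intro p hpS hnot
    by_cases hpU : p ∈ U
    · have huv : u p = 0 ∨ v p = 0 := (hS.not_mem_interior_iff hpU hpS).1 hnot
      show G p - 2 * u p * v p * (χ p * (1 - κ p)) = 1
      rw [hb1 p hpS hnot]
      rcases huv with h | h <;> simp [h]
    · have hpV : p ∉ V₁ := fun h => hpU (hV₁U h)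
      show G p - 2 * u p * v p * (χ p * (1 - κ p)) = 1
      rw [hχout p hpV, hb1 p hpS hnot]; ring
  have hi1' : ∀ p ∈ interior S, Gt p < 1 := by
    intro p hint
    by_cases hpV : p ∈ V₁
    · have hpOκ : p ∈ Oκ := hV₁Oκ hpV
      rw [hGtform p hpOκ]
      obtain ⟨hu', hv'⟩ := (hS.interior_iff p (hV₁U hpV) (interior_subset hint)).1 hint
      have hk := hkpos p hpOκ
      nlinarith [mul_pos (mul_pos hu' hv') hk]
    · show G p - 2 * u p * v p * (χ p * (1 - κ p)) < 1
      rw [hχout p hpV]; simpa using hi1 p hint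
  have hb2' : ∀ p ∈ S, p ∉ interior S → p ∉ F → ¬ IsMCriticalPt (𝓡 4) Gt p := by
    intro p hpS hnot hpF
    by_cases hpV : p ∈ V₁
    · exact hnear p hpS hpV hpF
    · rw [isMCriticalPt_congr_of_eventuallyEq_add_const (hGteq p hpV)]
      exact hb2 p hpS hnot hpF
  have hi2' : ∀ p ∈ interior S, IsMCriticalPt (𝓡 4) Gt p →
      (mhessian (𝓡 4) Gt p).Nondegenerate := by
    intro p hint hcrit
    have hpV : p ∉ V₁ := fun hpV =>
      hnear p (interior_subset hint) hpV (fun hpF => hS.not_mem_interior_of_mem_F hpF hint) hcrit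
    rw [mhessian_congr_of_eventuallyEq_add_const (hGteq p hpV)]
    rw [isMCriticalPt_congr_of_eventuallyEq_add_const (hGteq p hpV)] at hcrit
    exact hi2 p hint hcrit
  have hregT : ∀ p ∈ S, p ∈ T → p ∉ F → ¬ IsMCriticalPt (𝓡 4) Gt p := fun p hpS hpT hpF =>
    hnear p hpS (hTV₁ hpT) hpF
  have hc' : ∀ n, (interior S ∩ criticalSetOfIndex (𝓡 4) Gt n).ncard = c n := by
    intro n
    have hset : interior S ∩ criticalSetOfIndex (𝓡 4) Gt n =
        interior S ∩ criticalSetOfIndex (𝓡 4) G n := by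
      ext p
      simp only [mem_inter_iff, mem_criticalSetOfIndex]
      constructor
      · rintro ⟨hint, hcrit, hidx⟩
        have hpV : p ∉ V₁ := fun hpV =>
          hnear p (interior_subset hint) hpV (fun hpF => hS.not_mem_interior_of_mem_F hpF hint) hcrit
        refine ⟨hint, ?_, ?_⟩
        · rwa [isMCriticalPt_congr_of_eventuallyEq_add_const (hGteq p hpV)] at hcrit
        · unfold morseIndex at hidx ⊢
          rwa [mhessian_congr_of_eventuallyEq_add_const (hGteq p hpV)] at hidx
      · rintro ⟨hint, hcrit, hidx⟩
        have hpV : p ∉ V₁ := fun hpV =>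
          hnocrit p (interior_subset hint) (hV₁Oκ hpV)
            (fun hpF => hS.not_mem_interior_of_mem_F hpF hint) hcrit
        refine ⟨hint, ?_, ?_⟩
        · rwa [isMCriticalPt_congr_of_eventuallyEq_add_const (hGteq p hpV)]
        · unfold morseIndex at hidx ⊢
          rwa [mhessian_congr_of_eventuallyEq_add_const (hGteq p hpV)]
    rw [hset, hc n]
  exact ⟨T, Gt,
    { toSectorNormalForm := hS
      isOpen_T := hTo
      F_subset_T := hFT
      T_subset_O := fun y hy => hOκO (hV₁Oκ (hTV₁ hy))
      contMDiff_G := hGts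
      G_eq := hGtT
      G_eq_one := hb1'
      G_lt_one := hi1'
      regular_bd := hb2'
      nondeg := hi2'
      regular_T := hregT
      count := hc' }⟩

end Summit.SmoothPoincare4.SmoothPoincare4.Cruxes.AgkCor6Sufficiency.LpBySphereSystemSurgery

end
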